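import Literature.AlgebraicGeometry.Motives.GrassmannianPlucker
import Literature.AlgebraicGeometry.Motives.GrassmannianOneProjective
import HarnessLib

/-!
# The Grassmannian scheme `Gr(k, M)` is projective over `ℤ`

Topic `AlgebraicGeometry/Motives`; namespace `Literature.AlgebraicGeometry.Motives.Grassmannian`.  THEOREMS ONLY.  The composition of
★ F3 `GrassmannianPlucker.isProjective_terminal_from_of_one` (B-p12 (g15): the Plücker closed immersion
`Gr(k, M) ↪ Gr(1, ⋀ᵏM)` reduces projectivity of `Gr(k, M)` to that of `Gr(1, ⋀ᵏM)`) with ★ F4 `isProjective_terminal_from_one`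
(B-p09 (g13): `Gr(1, L)` is projective over `ℤ`, Hartshorne II 7.1/7.2 on the standard charts), for `L := ⋀ᵏM` (finite free by Mathlib
`exteriorPower.instFinite` / `instFree`, supplied by `haveI` as in F3 — instance search does not see them through
`AddCommGroup.toIntModule`; the representability instances by ★ (A4) `isRepresentable_grassmannianSheaf`):
**`isProjective_terminal_from : Morphisms.IsProjective (terminal.from (grassmannianScheme M k))`** — [GortzWedhorn2020, Cor. 8.15 (p. 216)
with (8.10) Prop. 8.23 (p. 220)]: «`Grass_{d,n}` is projective over `ℤ`».  This closes F-5 (a) of the cell's F-DAG («Grassmannian SCHEME,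
PROJECTIVE via Plücker»).  Nothing here is about HC — HC_CM is proved only modulo the 7 printed citations until rung 0 closes.
-/

universe u

open CategoryTheory CategoryTheory.Limits _root_.AlgebraicGeometry

namespace Literature.AlgebraicGeometry.Motives.Grassmannian

/-- **THE GRASSMANNIAN IS PROJECTIVE OVER `ℤ`**: for a finite free abelian group `M` and `k : ℕ`, the structure morphism
`grassmannianScheme M k → ⊤ = Spec ℤ` is projective in Hartshorne's sense (★ `Morphisms.IsProjective`), under the representability
instances of ★ `GrassmannianSheaf` §4 (both discharged by ★ `isRepresentable_grassmannianSheaf`).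
[cite: GortzWedhorn2020, (8.10) Prop. 8.23 (p. 220)] [cite: GortzWedhorn2020, Cor. 8.15 (p. 216)] [cite: Hartshorne1977, II Prop. 7.2] -/
theorem isProjective_terminal_from (M : Type u) [AddCommGroup M] (k : ℕ) [Module.Finite ℤ M] [Module.Free ℤ M]
    [(grassmannianSheaf M k).obj.IsRepresentable] [(grassmannianSheaf (⋀[ℤ]^k M) 1).obj.IsRepresentable] :
    Morphisms.IsProjective (terminal.from (grassmannianScheme M k)) :=
  haveI : Module.Finite ℤ (⋀[ℤ]^k M) := exteriorPower.instFinite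
  haveI : Module.Free ℤ (⋀[ℤ]^k M) := exteriorPower.instFree ℤ k
  isProjective_terminal_from_of_one M k (isProjective_terminal_from_one (⋀[ℤ]^k M))

/-- **Instance-free form**: with the representability instances supplied by ★ `isRepresentable_grassmannianSheaf`.
[cite: GortzWedhorn2020, (8.10) Prop. 8.23 (p. 220)] [cite: GortzWedhorn2020, Cor. 8.15 (p. 216)] -/
theorem isProjective_terminal_from' (M : Type u) [AddCommGroup M] (k : ℕ) [Module.Finite ℤ M] [Module.Free ℤ M] :
    haveI := isRepresentable_grassmannianSheaf M k
    Morphisms.IsProjective (terminal.from (grassmannianScheme M k)) := by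
  haveI := isRepresentable_grassmannianSheaf M k
  haveI : Module.Finite ℤ (⋀[ℤ]^k M) := exteriorPower.instFinite
  haveI : Module.Free ℤ (⋀[ℤ]^k M) := exteriorPower.instFree ℤ k
  haveI := isRepresentable_grassmannianSheaf (⋀[ℤ]^k M) 1
  exact isProjective_terminal_from M k

end Literature.AlgebraicGeometry.Motives.Grassmannian
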